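import Mathlib
import Literature.MathematicalPhysics.QuantumFieldTheory.Balaban1983to89.B5

/-!
# `Balaban1983to89.B6` — T. Balaban, *Propagators and renormalization transformations for lattice gauge
theories. II*, Commun. Math. Phys. **96**, 223–250 (1984).  (INDEX: B6; refs: [3] = B4 (Sect. 5 Theorem
meant where the text says "Sect. 5 [3]", DIVERGENCE D-r1.3), [4] = B5.)
PDF held: `paper:balaban1984-cmp96-propagators-rt-ii` (journal page = PDF page + 222).

CITATION HEADER (lean-in-tree rule 2026-08-18). This module is a TYPED SKELETON (statement level) of the published paper
T. Bałaban, "Propagators and renormalization transformations for lattice gauge theories. II", *Comm. Math. Phys.* **96**, 223–250 (1984) [Balaban1984PropagatorsII] (cell paper B6).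
WHAT IS REPRODUCED: the main theorems/propositions as `def … : Prop` carrying the VERBATIM printed statement in the docstring
(journal page + equation numbers), over abstract carrier structures whose Prop-valued fields name the printed hypotheses; plus a few
kernel-checked pieces of elementary arithmetic re-deriving printed constants (the audit's "second engine").  NOTHING of the series is
asserted: the series' end-statement (ultraviolet stability of 4-d lattice gauge theories, [Balaban1987RG1] Thm 2 ff.) is a CLAIM UNDER
ADJUDICATION by the audit cell `pub-balaban`; every `…Printed` Prop here is consumed downstream only as a hypothesis `(h : …Printed …)`.
The cell's line-by-line census of this paper (objections located to page/equation, certifications) is the cell's GAPS.md (ids quoted in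
the docstrings: C-… certified, G-… objection/flag, D-… divergence row of the cell's DIVERGENCE.md).  Why local carrier structures and not
the shared `Setup` vocabulary (`…Balaban1983to89.Setup`): this paper's statements quantify over operator KERNELS and norm functionals
(random-walk expansions, Hölder norms, weighted sup norms, quadratic forms) that `Setup` deliberately does not model; the carriers only
NAME those functionals as fields, so no `Setup` definition is restated here and nothing is defined twice.  Staged byte-identically in the
cell package `run/shared/lean/pub/pub-balaban/lean/BalabanYm4/Literature/MathematicalPhysics/QuantumFieldTheory/Balaban1983to89/B6.lean`
(legacy copy `BalabanYm4/B6.lean` there, namespace `BalabanYm4.B6`, same declarations).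

Unit `b2b-balaban-r1` (reader group A).  STATEMENT LEVEL ONLY: Lemma 2.1 (p. 234, with its CONCRETE
constants c₀(α), c₁(α) = 12c₀(½α)^d and condition (2.59)), Proposition 2.2 (p. 234), Proposition 2.3
(p. 238), Lemma 2.4 (p. 245, the finite-dimensional inequality (2.128)), Proposition 2.5 (p. 246),
Proposition 2.6 (p. 247, "our main technical result"), Proposition 2.7 (p. 249), Corollary 2.8 (p. 249),
and the lower bound (2.153).  U = 1 throughout (no background field) — this file is the INDUCTION BASE
that B9 Cor. 3.5 imports ("for U = 1 these theorems are proved in [4]"; GAPS G-B9-03 = entry-by-entry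
match still owed).  KERNEL-CHECKED: the numerical facts behind census G-B6-04 (Lemma 2.1 constants:
(e + 1)/(e − 1) < 2.165, e²/(e − 1) < 4.31, 4.31·2.165 ≤ 12; the α = ½ form of (2.59)).  Companion prose:
`HOME/b2b-balaban-r1/B6.md`; census rows G-B6-*, C-B6-1 in `HOME/GAPS.md`.

Unit `b2b-balaban-b06` (phase-2 paper sub-cell, 2026-08-18; section "Phase 2" at the end of this file).  ADDED:
Proposition 2.5 typed as its own predicate `Prop25Printed` over B5's `B5.Setting`/`B5.Ineq110_114` (this module now
imports `…B5`; cell node T03.5); Lemma 2.4 with a general factor κ (`Lemma24K`; κ = 1 ↔ `Lemma24Printed` by `Iff.rfl`)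
and the ASSEMBLY of (2.128) from the summed (2.123) and (2.127) KERNEL-CHECKED (`lemma24_assembly_core`,
`lemma24K_of_steps`: weights 1/(4d²), 1 — the step the paper leaves as "imply many other inequalities", census
G-B6-08); the bookkeeping implications (2.124) (`sq_sum_third`), (2.153)_κ (`lowerBound2153K_of_lemma24K`, with the
B5 (1.67) edge `h2118_of_B5`), (2.157) (`bound2157`), the geometric-series majorant behind (2.50)/(2.86)/(2.141)
(`neumann_majorant`); the STATED BLOCK `StatedBlock` (Lemma 2.1 ∧ … ∧ Cor. 2.8) for `Dag.Leaves.b6` /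
`DagBinding.Upstream.b6`, with `MainResults` (Prop. 2.6 ∧ Cor. 2.8) and `lemma24K_of_statedBlock` (replacing the
printed Lemma 2.4 by the repaired Lemma 2.4′, factor κ_L = min{1, 4L sin²(π/2L)}, costs nothing downstream);
v2: `kappaL`, `Lemma24Repaired` (= `Lemma24K` with κ = κ_L) with `lemma24Repaired_of_steps`/`_of_printed`, and the
exact failure of the printed (2.127) at d = 2, L = 10 (`plaqL10`, `faceL10_sums`, `ineq2127_fails_L10`: 4895 <
5211.956 on r1-g2's Δ′/Δ″ witness, census G-B6-09R §5.2).
Census of this unit: C-B6-2…5 (Sects. A, B, C re-derived line by line), G-B6-02 (G(Ω)/Dirichlet variants asserted),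
G-B6-10 (certification of G-B6-09R: Lemma 2.4′ PROVED in prose; the printed constant unproved as printed and
numerically supported with a factor ≥ 45 to spare in every computed case, N-B6-1/N-B6-2: d = 2…5, L ≤ 35),
G-B6-11/12 ((2.134) support-separation smallness, (2.148) decay asserted), addenda to G-B6-05/06/07 ([3] = B4).
Prose: `HOME/b2b-balaban-b06/{Lemma24-repair.md, N-B6-2.md}`.
Unit `b2b-balaban-b06-g3` (gen 3): DOCFIX only — the locator of condition (2.59) (`Cond259`) corrected to p. 233 [PDF 11]
(it was given as p. 234, the page of Lemma 2.1 which cites it; census aside of pv10, 2026-08-18); no declaration changed.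
The gen-3 kernel work on this paper lives in the siblings `…B6Elimination` (p. 242 site elimination), `…B6BondElimination`
(pp. 249–250 bond elimination B = CB′) and `…B6AdjointAveraging` (p. 248, ‖B₁‖² ≥ const‖B‖²).
Unit `b2b-balaban-b06-g5` (gen 5): DOCFIX only (v5) — the STATUS of Lemma 2.1 in the cell record is now stated in the
docstrings of `c1` and `Lemma21Printed` (the printed constant c₁(α) = 12c₀(½α)^d is REFUTED AS TYPED for d ≥ 3 by the
kernel witness of the sibling `…B6Lemma21Counterexample`, cell GAPS G-A11-1; repaired constants in `…B6Lemma21Arith` /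
`…B6Lemma21TwoScale`, parameter form in `…DagBinding` (`B6Lemma21Param`); `Lemma21Printed` is kept VERBATIM as the
printed statement); no declaration changed.  Later siblings of this lineage: `…B6WeightedEncoding`, `…B6KernelComposition`
(gen 3), `…B6Sect5Closed`, `…B6FrameReduction` (gen 4), `…B6Ineq268` (gen 5: the scale sum of (2.68) p. 235 needs, beyond
Lemma 2.1, δ₀RM ≥ 8 log L for a k-uniform O(1) — sufficient and necessary; GAPS C-b06g5-2).
-/

namespace Literature.MathematicalPhysics.QuantumFieldTheory.Balaban1983to89.B6

/-! ## Lemma 2.1 — summability over the multiscale set 𝔅 -/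

/-- c₀(α) := Σ_{z∈ℤ} e^{−αδ₀|z|} (p. 233). [cite: Balaban1984PropagatorsII, p.233] -/
noncomputable def c0 (δ₀ α : ℝ) : ℝ := ∑' z : ℤ, Real.exp (-(α * δ₀ * |(z : ℝ)|))

/-- c₁(α) := 12c₀(½α)^d (Lemma 2.1) — the PRINTED constant, kept verbatim.  Cell record: for d ≥ 3 it is exceeded by
the (2.61) row sum on the slab-witness geometries of `…B6Lemma21Counterexample` (`printed_c1_exceeded`: d = 4, L = 32,
αδ₀ = ⅛; GAPS G-A11-1 — the last crossing leg of (2.47) pays no factor e^{−½αδ₀RM}, so (2.58) carries (m−1)⁺, not m,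
transitions); the repaired value is `B6Lemma21Arith.c1Repaired` = 13c₀(½α)^{3d} (GAPS G-A12-1), resp.
`B6Lemma21TwoScale.c1TwoScale` = 13c₀(½α)^{4d} under the two-scale reading of the surface legs (GAPS G-A13-1, reading
disputed G-ref1-18); all consumers use c₁ only as an α-dependent O(1). [cite: Balaban1984PropagatorsII, Lemma 2.1 p.234] -/
noncomputable def c1 (d : ℕ) (δ₀ α : ℝ) : ℝ := 12 * c0 δ₀ (α / 2) ^ d

/-- Condition (2.59), displayed on p. 233 [PDF 11]: *"Now we require that RM is sufficiently large, i.e. we assume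
¼αδ₀RM > 2d log c₀(½α) + 1. (2.59)"* (Lemma 2.1 on p. 234 refers back to it: *"RM satisfying (2.59)"*).
[cite: Balaban1984PropagatorsII, (2.59) p.233] -/
def Cond259 (d : ℕ) (δ₀ α R M : ℝ) : Prop :=
  2 * d * Real.log (c0 δ₀ (α / 2)) + 1 < (1 / 4) * α * δ₀ * R * M

/-- Abstract multiscale geometry (2.1)–(2.4), (2.45)–(2.48) for fixed d, L: 𝔅 = ⋃_{j=0}^k Λ_j (a finite
set, `Site` with `Fintype`), scale index `scale`, multiscale distance d(y, y′) (2.46), parameters R, M of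
(2.1)–(2.2), spacing η = L^{−k}; plus the localisation vocabulary of Props 2.2–2.8 (as in `BalabanYm4.B9`):
arguments λ / J (`Loc`) with supp ⊂ B^{j′}(y′) or Δ(y′)/Δ̃(y′) (`suppIn`), |λ| (`supNorm`), ‖λ‖ (`l2Norm`),
Hölder norms ‖λ‖^{ξ′}_ε (`holder`), cut-offs ζ, h (`Cut`, `cutIn`, `cutH β ζ` = ‖ζ‖^ξ_β + |ζ|, `cutSup`). [cite: Balaban1984PropagatorsII, (2.1)–(2.4) + (2.45)–(2.48) pp.224–229] -/
structure Geometry where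
  Site : Type
  fin : Fintype Site
  scale : Site → ℕ
  dist : Site → Site → ℝ
  k : ℕ
  eta : ℝ
  L : ℝ
  R : ℝ
  M : ℝ
  /-- the geometric hypotheses (2.1), (2.2) on {Ω_j}, {Λ_j} with the parameters R, M -/
  Hyp21_22 : Prop
  Loc : Type
  suppIn : Loc → Site → Prop
  supNorm : Loc → ℝ
  l2Norm : Loc → ℝ
  holder : ℝ → Loc → ℝ
  Cut : Type
  cutIn : Cut → Site → Prop
  cutH : ℝ → Cut → ℝ
  cutSup : Cut → ℝ

-- `Geometry.fin` is the `Fintype` structure CARRIED by the abstract site type of `g : Geometry` (needed for the finite sums of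
-- Lemma 2.1); registering it cannot override a library instance because `g.Site` is a field of `g`, not a library type.
attribute [instance] Geometry.fin

/-- L^jη for y ∈ Λ_j. [cite: Balaban1984PropagatorsII, (2.1)–(2.2) p.224] -/
noncomputable def Geometry.len (g : Geometry) (y : g.Site) : ℝ := g.L ^ g.scale y * g.eta

/-- **Lemma 2.1** (p. 234 [PDF 12], verbatim): *"For the numbers α, 0 < α < 1, c₁(α) = 12c₀^d(½α), and RM
satisfying (2.59) we have e^{−αδ₀d(y,y′)} ≤ e^{−αδ₀RM max{|j−j′|−1,0}}, y ∈ Λ_j, y′ ∈ Λ_{j′}, (2.60)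
sup_{y∈𝔅} Σ_{y′∈𝔅} e^{−αδ₀d(y,y′)} ≤ c₁(α), (2.61) hence Σ_{y₁,…,y_n∈𝔅} e^{−αδ₀d(y,y₁)}⋯e^{−αδ₀d(y_{n−1},y_n)}
≤ c₁(α)^n (2.62) and Σ_{y₁,…,y_{n−1}∈𝔅} e^{−δ₀d(y,y₁)}⋯e^{−δ₀d(y_{n−1},y′)} ≤ c₁(α)^n e^{−(1−α)δ₀d(y,y′)}.
(2.63)"*  Typed: (2.60) and (2.61) ((2.62)–(2.63) are their formal consequences with the triangle
inequality (2.54)).  δ₀ = the decay rate of Prop. 2.2 (d, L only).  STATUS IN THE CELL RECORD (gen-5 DOCFIX; this Prop is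
kept VERBATIM as the printed statement — a hypothesis, never asserted): the ARITHMETIC (2.58) ⇒ (2.61) with the printed
intermediate constants is reproduced (census G-B6-04, the kernel-checked lemmas below; second engines GAPS C-A10-1,
C-adv9-35); the GEOMETRIC premise (2.57) holds for l ≤ m−1 only (the last leg of (2.47) ends at y′, not at a surface), so
the printed c₁(α) is REFUTED AS TYPED for d ≥ 3 (kernel witness `B6Lemma21Counterexample.printed_c1_exceeded`, GAPS
G-A11-1) and this Prop with it on those geometries; (2.60) is kernel-derived for realised geometries
(`B6Geometry.ineq260_of_levelGap`); consumers bind the generic-constant displays `B6Lemma21Repaired.Ineq261With` /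
`Lemma21Repaired` (c₁′ = 13c₀(½α)^{3d}, GAPS G-A12-1; two-scale variant `B6Lemma21TwoScale.c1TwoScale`, G-A13-1) or the
parameter form `DagBinding.B6Lemma21Param` (the implication from this Prop, `DagBinding.b6Lemma21Param_of_printed`, is the
settled negative edge).  [cite: Balaban1984PropagatorsII, Lemma 2.1 (2.60)–(2.61) p.234] -/
def Lemma21Printed {I : Type} (d : ℕ) (δ₀ : ℝ) (geo : I → Geometry) : Prop :=
  ∀ i : I, (geo i).Hyp21_22 → ∀ α : ℝ, 0 < α → α < 1 → Cond259 d δ₀ α (geo i).R (geo i).M →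
    (∀ y y' : (geo i).Site,
        Real.exp (-(α * δ₀ * (geo i).dist y y')) ≤
          Real.exp (-(α * δ₀ * (geo i).R * (geo i).M *
            max ((|((geo i).scale y : ℝ) - (geo i).scale y'|) - 1) 0))) ∧
    (∀ y : (geo i).Site, ∑ y' : (geo i).Site, Real.exp (-(α * δ₀ * (geo i).dist y y')) ≤ c1 d δ₀ α)

/-- G-B6-04 (ii), kernel-checked engine 2: Σ_{j′∈ℤ} e^{−|j−j′|} = (e + 1)/(e − 1) < 2.165. [folklore] -/
theorem coth_half_bound : (Real.exp 1 + 1) / (Real.exp 1 - 1) < 2.165 := by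
  have h := Real.exp_one_gt_d9
  rw [div_lt_iff₀ (by linarith)]
  linarith

/-- G-B6-04 (ii): the m-sum constant (e/(e−1))·e = e²/(e − 1) < 4.31 (the print has the loose value 6). [folklore] -/
theorem msum_constant_bound : Real.exp 1 ^ 2 / (Real.exp 1 - 1) < 4.31 := by
  have h1 := Real.exp_one_gt_d9
  have h2 := Real.exp_one_lt_d9
  rw [div_lt_iff₀ (by linarith)]
  nlinarith

/-- G-B6-04 (ii): hence the true constant 4.31 × 2.165 ≤ 12, so c₁(α) = 12c₀(½α)^d IS valid. [folklore] -/
theorem c1_twelve_valid : (4.31 : ℝ) * 2.165 ≤ 12 := by norm_num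

/-- G-B6-04 (iii), kernel-checked: with α = ½ condition (2.59) is δ₀RM > 16d log c₀(¼) + 8
(the print simplifies it to "+ 1"). [folklore] -/
theorem cond259_half_iff (d : ℕ) (δ₀ R M : ℝ) :
    Cond259 d δ₀ (1 / 2) R M ↔ 16 * d * Real.log (c0 δ₀ (1 / 4)) + 8 < δ₀ * R * M := by
  unfold Cond259
  norm_num
  constructor <;> intro h <;> linarith

/-- G-B6-04 (i), recorded (not re-proved here): the step 2(1 − e^{−t})^{−1} < 4/t of p. 233 requires
t = αδ₀ < 1.5936…; typed as the hypothesis under which the printed chain c₀(α) < 2(1 − e^{−αδ₀})^{−1} < 4/(αδ₀)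
is used. [cite: Balaban1984PropagatorsII, p.233] -/
def SmallRate (δ₀ α : ℝ) : Prop := α * δ₀ < 1.59

/-! ## Propositions 2.2, 2.3 — the operators G′ and (Q′G′²Q′*)^{−1} -/

/-- An operator seen through the six quantities of (2.67): sup over x ∈ B^j(y) of |(G′λ)(x)|,
|(∇G′λ)(x)|, |(G′∇*λ)(x)|, then ‖ζ∇G′λ‖_α, ‖ζG′∇*λ‖_α (max of the two, `h1`), and |(ΔG′λ)(x)|. [cite: Balaban1984PropagatorsII, (2.67) p.234] -/
structure GpFamily (g : Geometry) where
  e : Fin 4 → g.Loc → g.Site → ℝ     -- entries 0,1,2 and 5 of (2.67): G′, ∇G′, G′∇*, ΔG′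
  h1 : g.Loc → ℝ → g.Cut → ℝ

/-- prefactors [(L^jη)², L^jη, L^jη, 1]. [cite: Balaban1984PropagatorsII, (2.67) p.234] -/
noncomputable def pref4 (t : ℝ) : Fin 4 → ℝ := ![t ^ 2, t, t, 1]
/-- prefactors [(L^jη)², L^jη, L^jη, 1, 1, 1] of (2.140). [cite: Balaban1984PropagatorsII, (2.140) p.247] -/
noncomputable def pref6 (t : ℝ) : Fin 6 → ℝ := ![t ^ 2, t, t, 1, 1, 1]

/-- **Proposition 2.2** (p. 234 [PDF 12], verbatim): *"If we have (2.1), (2.2) and M is sufficiently large,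
then the operator G′ = Δ′_a^{−1} (a = 1) satisfies the inequalities |(G′λ)(x)|, |(∇G′λ)(x)|, |(G′∇*λ)(x)|,
‖ζ∇G′λ‖_α, ‖ζG′∇*λ‖_α, |(ΔG′λ)(x)| ≤ O(1)[(L^jη)², L^jη, L^jη, (L^jη)^{1−α}(‖ζ‖_α + |ζ|),
(L^jη)^{1−α}(‖ζ‖_α + |ζ|), 1]·e^{−½δ₀d(y,y′)}|λ|, x ∈ B^j(y) or supp ζ ⊂ B^j(y), y ∈ Λ_j, supp λ ⊂ B^{j′}(y′),
y′ ∈ Λ_{j′}. (2.67)  The random walk representation (2.50) is convergent in the norms defined by these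
inequalities."*  (0 ≤ α < 1 with an α-dependent O(1), as in B5 Prop. 1.2.) [cite: Balaban1984PropagatorsII, Prop. 2.2 (2.67) p.234] -/
def Prop22Printed {I : Type} (geo : I → Geometry) (Gp : ∀ i, GpFamily (geo i)) : Prop :=
  ∃ M₁ δ₀ C : ℝ, ∃ Cα : ℝ → ℝ, 0 < M₁ ∧ 0 < δ₀ ∧ 0 < C ∧
    ∀ i : I, (geo i).Hyp21_22 → M₁ ≤ (geo i).M →
      (∀ (n : Fin 4) (lam : (geo i).Loc) (y y' : (geo i).Site), (geo i).suppIn lam y' →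
          (Gp i).e n lam y ≤ C * pref4 ((geo i).len y) n * Real.exp (-(δ₀ / 2 * (geo i).dist y y')) *
            (geo i).supNorm lam) ∧
      (∀ (α : ℝ) (lam : (geo i).Loc) (ζ : (geo i).Cut) (y y' : (geo i).Site), 0 ≤ α → α < 1 →
          (geo i).cutIn ζ y → (geo i).suppIn lam y' →
          (Gp i).h1 lam α ζ ≤ Cα α * ((geo i).len y) ^ (1 - α) * (geo i).cutH α ζ *
            Real.exp (-(δ₀ / 2 * (geo i).dist y y')) * (geo i).supNorm lam)

/-- A two-point kernel on 𝔅 (or on 𝔅-bonds). [cite: Balaban1984PropagatorsII, (2.87) + (2.149) pp.238 + 249] -/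
structure SiteKernel (g : Geometry) where
  ker : g.Site → g.Site → ℝ

/-- **Proposition 2.3** (p. 238 [PDF 16], verbatim): *"An inverse of the operator Q′G′²Q′* is given by the
convergent expansion (Q′G′²Q′*)^{−1} = C(I − R)^{−1} = Σ_{n=0}^∞ CR^n = Σ_ω h_{□₀}C_{□₀}h_{□₀}R_{□₁,□₂}C_{□₂}h_{□₂}⋯
R_{□_{2n−1},□_{2n}}C_{□_{2n}}h_{□_{2n}}, (2.86) and it satisfies the estimate |(Q′G′²Q′*)^{−1}(y, y′)| ≤
O(1)(L^jη)^{−4}(L^{j′}η)^{−d}e^{−½δ₁d(y,y′)} y, y′ ∈ 𝔅, y ∈ Λ_j, y′ ∈ Λ_{j′}. (2.87)"*  (δ₁ from (2.79) —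
GAPS G-B6-05: asserted via "Sect. 5 [3]" = B4 Sect. 5.) [cite: Balaban1984PropagatorsII, Prop. 2.3 (2.86)–(2.87) p.238] -/
def Prop23Printed {I : Type} (d : ℕ) (geo : I → Geometry) (Cinv : ∀ i, SiteKernel (geo i)) : Prop :=
  ∃ M₁ δ₁ C : ℝ, 0 < M₁ ∧ 0 < δ₁ ∧ 0 < C ∧
    ∀ i : I, (geo i).Hyp21_22 → M₁ ≤ (geo i).M → ∀ y y' : (geo i).Site,
      |(Cinv i).ker y y'| ≤ C * ((geo i).len y) ^ (-(4 : ℝ)) * ((geo i).len y') ^ (-(d : ℝ)) *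
        Real.exp (-(δ₁ / 2 * (geo i).dist y y'))

/-! ## Lemma 2.4 — the tree-gauge lower bound on the unit lattice -/

/-- Abstract carrier of Lemma 2.4: Λ ⊂ ℤ^d a union of L-blocks, Λ = B(Λ′); configurations B on the bonds
meeting Λ (B = 0 outside); `TreeGauge B` = condition (2.121): B(Γ_{y,x}) = 0 for x ∈ B(y), y ∈ Λ′;
`q1Sq B` = Σ_{c∈Λ′} |(Q₁B)(c)|², `d1Sq B` = Σ_p |(∂₁B)(p)|², `normSq B` = ‖B‖² = Σ_b |B(b)|². [cite: Balaban1984PropagatorsII, (2.121) p.244] -/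
structure TreeData where
  Cfg : Type
  TreeGauge : Cfg → Prop
  q1Sq : Cfg → ℝ
  d1Sq : Cfg → ℝ
  normSq : Cfg → ℝ

/-- **Lemma 2.4** (p. 245 [PDF 23], verbatim): *"Let a set Λ ⊂ Z^d be a sum of blocks, Λ = B(Λ′). We denote
by Λ also a set of bonds b such that at least one of the end-points b₋, b₊ belongs to Λ. Let B be a
configuration defined on Λ and satisfying the condition (2.121): B(Γ_{y,x}) = 0 for x ∈ B(y), y ∈ Λ′. We put
B = 0 outside Λ. Then the following inequality holds
L^{d−2} Σ_{c∈Λ′} |(Q₁B)(c)|² + Σ_p |(∂₁B)(p)|² ≥ (1/(12d²)) L^{−d−1} ‖B‖². (2.128)"*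
GAPS G-B6-08: the assembly of (2.128) from (2.123), (2.127) with the constant 1/(12d²) is NOT written in
print — it is KERNEL-CHECKED below (`lemma24_assembly_core`, `lemma24K_of_steps`: G-B6-08 closed), while the
printed route is false at (2.127) for L ≥ 10 (G-B6-09/09R; `ineq2127_fails_L10` at L = 10) and the repaired
constant κ_L/(12d²) is proved (`Lemma24Repaired`, G-B6-10); the printed constant itself holds numerically with a
factor ≥ 45 in every computed case (N-B6-1 exact, N-B6-2 float; d = 2…5).  Family index = (d, L fixed; Λ arbitrary). [cite: Balaban1984PropagatorsII, Lemma 2.4 (2.128) p.245] -/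
def Lemma24Printed {I : Type} (d : ℕ) (L : ℝ) (fam : I → TreeData) : Prop :=
  ∀ i : I, ∀ B : (fam i).Cfg, (fam i).TreeGauge B →
    (1 / (12 * (d : ℝ) ^ 2)) * L ^ (-((d : ℝ) + 1)) * (fam i).normSq B ≤
      L ^ ((d : ℝ) - 2) * (fam i).q1Sq B + (fam i).d1Sq B

/-! ## Propositions 2.5–2.7, Corollary 2.8 — the operators G, (QGQ*)^{−1}, H -/

/-- An operator seen through the quantities of Prop. 2.6 / B5 Prop. 1.2: `e n` (n = 0…3) = sup over
x ∈ Δ(y) of |(GJ)(x)|, |(∇GJ)(x)|, |(G∇*J)(x)|, |(ΔGJ)(x)| (2.136); `h1 α ζ` = ‖ζ∇GJ‖_α, ‖ζG∇*J‖_α (2.137);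
`e4` = |(∇G∇*J)(x)| (2.138); `h2 α ζ` = ‖ζ∇G∇*J‖_α (2.139); `l2 n h` = the six L² quantities of (2.140). [cite: Balaban1984PropagatorsII, (2.136)–(2.140) p.247] -/
structure GFamily (g : Geometry) where
  e : Fin 4 → g.Loc → g.Site → ℝ
  h1 : g.Loc → ℝ → g.Cut → ℝ
  e4 : g.Loc → g.Site → ℝ
  h2 : g.Loc → ℝ → g.Cut → ℝ
  l2 : Fin 6 → g.Loc → g.Cut → ℝ

/-- The inequalities (2.136)–(2.140) for one operator with constants (C, C(α), C(ε), C(α, ε), δ₃). [cite: Balaban1984PropagatorsII, (2.136)–(2.140) p.247] -/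
def Ineq2136_2140 {g : Geometry} (G : GFamily g) (C : ℝ) (Cα Cε : ℝ → ℝ) (Cαε : ℝ → ℝ → ℝ) (δ₃ : ℝ) :
    Prop :=
  (∀ (n : Fin 4) (J : g.Loc) (y y' : g.Site), g.suppIn J y' →
      G.e n J y ≤ C * pref4 (g.len y) n * Real.exp (-(δ₃ * g.dist y y')) * g.supNorm J) ∧
  (∀ (α : ℝ) (J : g.Loc) (ζ : g.Cut) (y y' : g.Site), 0 ≤ α → α < 1 → g.cutIn ζ y → g.suppIn J y' →
      G.h1 J α ζ ≤ Cα α * (g.len y) ^ (1 - α) * g.cutH α ζ * Real.exp (-(δ₃ * g.dist y y')) * g.supNorm J) ∧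
  (∀ (ε : ℝ) (J : g.Loc) (y y' : g.Site), 0 < ε → ε < 1 → g.suppIn J y' →
      G.e4 J y ≤ Cε ε * Real.exp (-(δ₃ * g.dist y y')) * (g.holder ε J + g.supNorm J)) ∧
  (∀ (α ε : ℝ) (J : g.Loc) (ζ : g.Cut) (y y' : g.Site), 0 ≤ α → 0 < ε → α + ε < 1 →
      g.cutIn ζ y → g.suppIn J y' →
      G.h2 J α ζ ≤ Cαε α ε * (g.len y) ^ (-α) * g.cutH α ζ * Real.exp (-(δ₃ * g.dist y y')) *
        (g.holder (α + ε) J + g.supNorm J)) ∧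
  (∀ (n : Fin 6) (J : g.Loc) (h : g.Cut) (y y' : g.Site), g.cutIn h y → g.suppIn J y' →
      G.l2 n J h ≤ C * pref6 (g.len y) n * g.cutSup h * Real.exp (-(δ₃ * g.dist y y')) * g.l2Norm J)

/-- **Proposition 2.6** (p. 247 [PDF 25], verbatim frame): *"There exists a positive constant δ₃ depending on
d and L only, such that |(GJ)(x)|, |(∇GJ)(x)|, |(G∇*J)(x)|, |(ΔGJ)(x)| ≤ O(1)[(L^jη)², L^jη, L^jη, 1]
e^{−δ₃d(y,y′)}|J| (2.136) for x ∈ Δ(y), y ∈ Λ_j, supp J ⊂ Δ(y′), with the constant O(1) depending on d and L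
only; [(2.137)–(2.140) with constants depending on d, L, α, ε — full display in B6.md §3] … The operator G
can be represented as G = G₀(I − R)^{−1} = … (2.141) and the series above is convergent in the norms
appearing in the inequalities (2.136)–(2.140)."*  ("our main technical result", p. 249; holds also for
G(Ω) with Dirichlet conditions, p. 248.)  **Proposition 2.5** (p. 246) = the same inequalities ((1.110)–
(1.114) of B5 Prop. 1.2 with δ₂) for each LOCAL operator G_□ of (2.90) — typed separately as `Prop25Printed`
below (phase 2) over B5's own predicate `B5.Ineq110_114`; its proof chain has the asserted links G-B6-06, G-B6-07. [cite: Balaban1984PropagatorsII, Prop. 2.6 (2.136)–(2.141) p.247] -/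
def Prop26Printed {I : Type} (geo : I → Geometry) (G : ∀ i, GFamily (geo i)) : Prop :=
  ∃ M₁ δ₃ C : ℝ, ∃ Cα Cε : ℝ → ℝ, ∃ Cαε : ℝ → ℝ → ℝ, 0 < M₁ ∧ 0 < δ₃ ∧ 0 < C ∧
    ∀ i : I, (geo i).Hyp21_22 → M₁ ≤ (geo i).M → Ineq2136_2140 (G i) C Cα Cε Cαε δ₃

/-- **Proposition 2.7** (p. 249 [PDF 27], verbatim): *"The operator (QGQ*)^{−1} is given by the convergent
expansions of the form (2.86), and it satisfies the bound |(QGQ*)^{−1}(b, b′)| ≤ O(1)(L^jη)^{−2}(L^{j′}η)^{−d}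
e^{−½δ₄d(b,b′)}, b ∈ Λ_j, b′ ∈ Λ_{j′}. (2.149)"*  (kernel on 𝔅-bonds, typed on `Site` = bonds.) [cite: Balaban1984PropagatorsII, Prop. 2.7 (2.149) p.249] -/
def Prop27Printed {I : Type} (d : ℕ) (geo : I → Geometry) (Qinv : ∀ i, SiteKernel (geo i)) : Prop :=
  ∃ M₁ δ₄ C : ℝ, 0 < M₁ ∧ 0 < δ₄ ∧ 0 < C ∧
    ∀ i : I, (geo i).Hyp21_22 → M₁ ≤ (geo i).M → ∀ b b' : (geo i).Site,
      |(Qinv i).ker b b'| ≤ C * ((geo i).len b) ^ (-(2 : ℝ)) * ((geo i).len b') ^ (-(d : ℝ)) *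
        Real.exp (-(δ₄ / 2 * (geo i).dist b b'))

/-- The kernel of H = GQ*(QGQ*)^{−1} (2.130)/(2.150) seen through |H(b, c)|, |(∇H)(b, c)| (sup over b ∈ Δ(y))
and ‖(ζ∇H)(·, c)‖_α. [cite: Balaban1984PropagatorsII, (2.130) + (2.150) pp.242 + 249] -/
structure HFamily (g : Geometry) where
  e : Fin 2 → g.Site → g.Site → ℝ
  h : ℝ → g.Cut → g.Site → ℝ

/-- **Corollary 2.8** (p. 249 [PDF 27], verbatim): *"A kernel of the operator H, (HB)(b) = Σ_{c∈𝔅}(L^{j(c)}η)^d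
H(b, c)B(c), (2.150) satisfies the inequality |H(b, c)|, |(∇H)(b, c)|, ‖(ζ∇H)(·, c)‖_α ≤ O(1)[1, (L^jη)^{−1},
(L^jη)^{−1−α}(‖ζ‖^ξ_α + |ζ|)](L^{j′}η)^{−d}e^{−δ₅d(y,c₋)}, (1.151)[sic] b ∈ Δ(y) or supp ζ ⊂ Δ(y), y ∈ Λ_j,
c₋ ∈ Λ_{j′}."*  ("This Corollary and Proposition 2.6 are our main technical results.") [cite: Balaban1984PropagatorsII, Cor. 2.8 (2.150)–(2.151) p.249] -/
def Cor28Printed {I : Type} (d : ℕ) (geo : I → Geometry) (H : ∀ i, HFamily (geo i)) : Prop :=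
  ∃ M₁ δ₅ C : ℝ, ∃ Cα : ℝ → ℝ, 0 < M₁ ∧ 0 < δ₅ ∧ 0 < C ∧
    ∀ i : I, (geo i).Hyp21_22 → M₁ ≤ (geo i).M →
      (∀ (n : Fin 2) (y c : (geo i).Site),
          (H i).e n y c ≤ C * ((geo i).len y) ^ (-(n : ℝ)) * ((geo i).len c) ^ (-(d : ℝ)) *
            Real.exp (-(δ₅ * (geo i).dist y c))) ∧
      (∀ (α : ℝ) (ζ : (geo i).Cut) (y c : (geo i).Site), 0 ≤ α → α < 1 → (geo i).cutIn ζ y →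
          (H i).h α ζ c ≤ Cα α * ((geo i).len y) ^ (-(1 + α)) * (geo i).cutH α ζ *
            ((geo i).len c) ^ (-(d : ℝ)) * Real.exp (-(δ₅ * (geo i).dist y c)))

/-- **(2.153)** p. 249 [PDF 27] (verbatim content): Δ_k ≥ (γ₀/(12d²))L^{−d−1} on {QB = 0, B(Γ_{y,x}) = 0} —
from (2.118) (γ₀‖∂₁B‖² ≤ ⟨B, Δ_kB⟩, = B5 (1.67)) and Lemma 2.4; the positivity input of the next
renormalization step's unit-lattice covariance C^{(k)}_Λ (2.154)–(2.157).  Typed over `TreeData` extended by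
the quadratic form `formΔk` and the constraint `QZero`. [cite: Balaban1984PropagatorsII, (2.153) p.249] -/
def LowerBound2153 {I : Type} (d : ℕ) (L γ₀ : ℝ) (fam : I → TreeData)
    (formΔk : ∀ i, (fam i).Cfg → ℝ) (QZero : ∀ i, (fam i).Cfg → Prop) : Prop :=
  ∀ i : I, ∀ B : (fam i).Cfg, (fam i).TreeGauge B → QZero i B →
    (γ₀ / (12 * (d : ℝ) ^ 2)) * L ^ (-((d : ℝ) + 1)) * (fam i).normSq B ≤ formΔk i B

/-- Bookkeeping (kernel-checked): (2.153) follows from Lemma 2.4 and (2.118) exactly as the text says,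
once QB = 0 kills the Q₁-term — typed: if `q1Sq B = 0` under `QZero` and γ₀·d1Sq ≤ formΔk, then (2.153). [folklore] -/
theorem lowerBound2153_of_lemma24 {I : Type} (d : ℕ) (L γ₀ : ℝ) (hγ : 0 ≤ γ₀) (fam : I → TreeData)
    (formΔk : ∀ i, (fam i).Cfg → ℝ) (QZero : ∀ i, (fam i).Cfg → Prop)
    (h24 : Lemma24Printed d L fam)
    (hQ : ∀ i B, QZero i B → (fam i).q1Sq B = 0)
    (h2118 : ∀ i B, γ₀ * (fam i).d1Sq B ≤ formΔk i B) :
    LowerBound2153 d L γ₀ fam formΔk QZero := by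
  intro i B hT hQ0
  have h := h24 i B hT
  rw [hQ i B hQ0, mul_zero, zero_add] at h
  have h' := mul_le_mul_of_nonneg_left h hγ
  calc γ₀ / (12 * (d : ℝ) ^ 2) * L ^ (-((d : ℝ) + 1)) * (fam i).normSq B
      = γ₀ * ((1 / (12 * (d : ℝ) ^ 2)) * L ^ (-((d : ℝ) + 1)) * (fam i).normSq B) := by ring
    _ ≤ γ₀ * (fam i).d1Sq B := h'
    _ ≤ formΔk i B := h2118 i B

/-! ### Census of the step (2.126) → (2.127), p. 245 [PDF 23] (G-B6-09, added 2026-08-18)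

Between (2.126) and (2.127) the text asserts: the (d−1)-dimensional form
`L^{−d} Σ_{b⊂Δ′} |(∂B_μ)(b)|² + L^{−2} |Σ_{x∈Δ′} L^{−(d−1)} B_μ(x)|²` "is bounded from below by
`L^{−d−1} Σ_{x∈Δ′} |B_μ(x)|²`".  Splitting `B_μ = const + g` (Σ g = 0) the claim is equivalent to
`λ₁(P_L^{d−1}) = 2 − 2cos(π/L) ≥ 1/L`, true for `2 ≤ L ≤ 9` and FALSE for every `L ≥ 10` (d ≥ 2).
Below: an exact integer witness for `d = 2`, `L = 10` (Δ′ = a path of 10 sites), kernel-checked by `decide`.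
With `Σ g = 0` the claim reads `L · Σ_b |∇g(b)|² ≥ Σ_x |g(x)|²`. -/

/-- Sum of squared nearest-neighbour differences along a path. [cite: Balaban1984PropagatorsII, (2.126)–(2.127) p.245] -/
def pathGradSq : List ℤ → ℤ
  | a :: b :: t => (b - a) ^ 2 + pathGradSq (b :: t)
  | _ => 0

/-- Sum of squares. [cite: Balaban1984PropagatorsII, (2.126)–(2.127) p.245] -/
def sumSq (g : List ℤ) : ℤ := (g.map fun a => a ^ 2).sum

/-- Rounded first Neumann mode `1000·cos(π(i+½)/10)`, `i = 0,…,9`. [cite: Balaban1984PropagatorsII, (2.126)–(2.127) p.245] -/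
def witnessL10 : List ℤ := [988, 891, 707, 454, 156, -156, -454, -707, -891, -988]

/-- The witness has mean zero, so the averaging term `|Σ_x L^{−(d−1)} B_μ(x)|²` vanishes exactly. [folklore] -/
theorem witnessL10_sum : witnessL10.sum = 0 := by decide

/-- Σ|∇g|² = 489 500 for the witness (kernel-checked). [folklore] -/
theorem witnessL10_gradSq : pathGradSq witnessL10 = 489500 := by decide

/-- Σ g² = 5 000 652 for the witness (kernel-checked). [folklore] -/
theorem witnessL10_sumSq : sumSq witnessL10 = 5000652 := by decide

/-- **G-B6-09 (kernel-checked counterexample).**  For `L = 10`, `d = 2`: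
`L · Σ|∇g|² = 4 895 000 < 5 000 652 = Σ|g|²`, i.e. the lower bound asserted between (2.126) and (2.127)
fails (ratio 0.9789); hence (2.127) and the constant `1/(12d²)` of (2.128) are unsupported for `L ≥ 10`.
For the `L` of B4/B5 ("e.g. L = 2 or 3") the asserted bound holds with factor ≥ 3 to spare. [folklore] -/
theorem claim_p245_fails_L10 : 10 * pathGradSq witnessL10 < sumSq witnessL10 := by decide

/-- The same witness shows the sharp factor: `Σ|∇g|²/Σ|g|² < 0.0979 < 1/10` (as rationals). [folklore] -/
theorem witnessL10_ratio : (489500 : ℚ) / 5000652 < 979 / 10000 := by norm_num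

/-! ## Phase 2 (unit `b2b-balaban-b06`, 2026-08-18) — Proposition 2.5 typed (cell node T03.5); the ASSEMBLY of
Lemma 2.4 kernel-checked with a general factor κ (census G-B6-08/09/10: κ = 1 is the printed (2.128), κ = κ_L =
min{1, 4L sin²(π/2L)} ≥ min{1, 8/L} the repaired Lemma 2.4′); bookkeeping implications (2.124), (2.153)_κ, (2.157),
the convergence majorant behind (2.50)/(2.86)/(2.141); the STATED BLOCK of the paper for `Dag.Leaves.b6` /
`DagBinding.Upstream.b6`.  Prose: `HOME/b2b-balaban-b06/Lemma24-repair.md`, `N-B6-2.md`; census rows C-B6-2…5,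
G-B6-02, G-B6-10, G-B6-11, G-B6-12 in `HOME/GAPS.md`.  Value = typed skeleton + located gaps, NOT summit progress. -/

/-! ### Proposition 2.5 — the local two-scale operators G_□ (2.90) -/

/-- Carrier for Proposition 2.5: ONE local operator G_□ = (Δ − ∂P_□∂* + Q*aQ)⁻¹ of (2.90) on the torus T_□ (or on
ξℤ^d), rescaled to the L^{−j}-lattice by (2.94), seen through exactly the functionals of B5 Prop. 1.2
(`B5.Setting`: the quantities of (1.110)–(1.114) over unit cubes Δ̃(y)); `Repr2129` NAMES the identity (2.129)
⟨J, G_□J⟩ = ⟨J, ∂H′_jC′^{(j)}_ΛH′_j*∂*J⟩ + ⟨(J − ∂ΔH′_jC′^{(j)}_ΛH′_j*∂*J), (G̃_j + H_jC̃^{(j)}_ΛH_j*)(J − ∂ΔH′_jC′^{(j)}_ΛH′_j*∂*J)⟩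
for this operator (its ingredients H′_j (2.101), Δ′_j (2.107), C′^{(j)}_Λ, G̃_j (2.131), H_j (2.130), C̃^{(j)}_Λ are
not modelled). [cite: Balaban1984PropagatorsII, (2.90) + (2.94) + (2.129) pp.239–246] -/
structure LocalOp where
  S : B5.Setting
  /-- the representation (2.129) holds for this G_□ -/
  Repr2129 : Prop

/-- **Proposition 2.5** (p. 246 [PDF 24], verbatim): *"The operator G_□ defined by (2.90) on the torus T_□ (or on the
whole lattice ξZ^d) has the representation (2.129) and satisfies all the inequalities (1.110)–(1.114) of the
Proposition 1.2 with a positive constant δ₂ instead of δ₀. This constant depends on d and L only."*  Typed over the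
family of ALL local operators of the construction (index i = (geometry (2.1)–(2.2), scale j, Λ = □̃² ∩ B^{j+1}(Λ_{j+1}),
cube □ ∈ 𝒟)): (2.129) for each i, and B5's predicate `B5.Ineq110_114` with ONE δ₂ and O(1)'s chosen before i (d and
L fixed).  Proof offered in print: "All the above considerations imply the following" — the chain (2.95)–(2.132):
Faddeev–Popov / gauge algebra (2.95)–(2.119) [re-derived: census C-B6-5]; Lemma 2.4 [(2.128): G-B6-08/09/10];
bounds for H′_j from (2.101)/(2.132) by "the analyticity method described in [3]" [asserted: G-B6-06, which thereby
inherits G-B4-02]; decay of C′^{(j)}_Λ, C̃^{(j)}_Λ "from the theorem on unit lattice operators in [3]" = B4 Sect. 5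
Theorem [asserted: G-B6-07]; B5 Prop. 1.2 and (1.99)–(1.101) for G_j, H_j, G̃_j [imported leaves]. [cite: Balaban1984PropagatorsII, Prop. 2.5 p.246] -/
def Prop25Printed {I : Type} (loc : I → LocalOp) : Prop :=
  (∀ i : I, (loc i).Repr2129) ∧
  ∃ δ₂ C : ℝ, ∃ Cα Cε : ℝ → ℝ, ∃ Cαε : ℝ → ℝ → ℝ, 0 < δ₂ ∧ 0 < C ∧
    ∀ i : I, B5.Ineq110_114 (loc i).S C Cα Cε Cαε δ₂

/-- DAG edge B5 → B6 at the type level (kernel-checked): the inequality half of Proposition 2.5 IS B5's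
Proposition 1.2 predicate `B5.Prop12Printed`, instantiated at the family of local operators G_□ (δ₀ ↦ δ₂). [folklore] -/
theorem prop12Shape_of_prop25 {I : Type} (loc : I → LocalOp) (h : Prop25Printed loc) :
    B5.Prop12Printed (fun i => (loc i).S) := h.2

/-! ### Lemma 2.4 — the assembly of (2.128), kernel-checked, with a general factor κ (census G-B6-08/09/10) -/

/-- The elementary inequality behind (2.124) and (2.125) (p. 245): (a + b + c)² ≥ ⅓a² − b² − c² for all reals
(3((a+b+c)² + b² + c²) − a² = (a+2b+c)² + (a+b+2c)² + (b−c)²).  In (2.124): (∂₁B)(p) = −(∂B_μ)(b) + B(b″) − B(b). [cite: Balaban1984PropagatorsII, (2.124) p.245] -/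
theorem sq_sum_third (a b c : ℝ) : a ^ 2 / 3 - b ^ 2 - c ^ 2 ≤ (a + b + c) ^ 2 := by
  nlinarith [sq_nonneg (a + 2 * b + c), sq_nonneg (a + b + 2 * c), sq_nonneg (b - c)]

/-- Refinement of `TreeData` used by the assembly of (2.128): ‖B‖² = N_in + N_cr (bonds inside one block of Λ / bonds
joining two blocks or leaving Λ); Σ_p|(∂₁B)(p)|² ≥ P_in + P_cr (plaquettes inside one block / the plaquettes "p ⊂ B(c)"
of (2.124), spanned by a bond of the last layer Δ′ of B(c₋) and the direction of c — two disjoint families); all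
quantities ≥ 0. [cite: Balaban1984PropagatorsII, (2.123)–(2.127) pp.244–245] -/
structure SplitData (T : TreeData) where
  nIn : T.Cfg → ℝ
  nCr : T.Cfg → ℝ
  pIn : T.Cfg → ℝ
  pCr : T.Cfg → ℝ
  norm_split : ∀ B, T.normSq B = nIn B + nCr B
  d1_split : ∀ B, pIn B + pCr B ≤ T.d1Sq B
  nIn_nonneg : ∀ B, 0 ≤ nIn B
  nCr_nonneg : ∀ B, 0 ≤ nCr B
  pIn_nonneg : ∀ B, 0 ≤ pIn B
  pCr_nonneg : ∀ B, 0 ≤ pCr B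
  q1_nonneg : ∀ B, 0 ≤ T.q1Sq B

/-- (2.123) p. 244 (verbatim): *"Σ_{b⊂B(y)} |B(b)|² ≤ dL^d Σ_{p⊂B(y)} |(∂₁B)(p)|²"* (tree-gauge Poincaré inequality
inside one block; its derivation p. 244 is complete), summed over the blocks of Λ: L^{−d}N_in ≤ d·P_in. [cite: Balaban1984PropagatorsII, (2.123) p.244] -/
def Step2123 (d : ℕ) (L : ℝ) (T : TreeData) (S : SplitData T) : Prop :=
  ∀ B, T.TreeGauge B → (L⁻¹) ^ d * S.nIn B ≤ d * S.pIn B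

/-- (2.127) p. 245 (verbatim): *"L^{−d} Σ_{p⊂B(c)} |(∂₁B)(p)|² + |(Q₁B)(c)|² ≥ ⅓L^{−d−1} Σ_{b∈B(c)} |B(b)|² − L^{−d}
Σ_{b⊂B(c₋)} |B(b)|² − L^{−d} Σ_{b⊂B(c₊)} |B(b)|²"*, with the factor ⅓ replaced by κ/3 and summed over the coarse
bonds c ∈ Λ′ (every block is c₋ of d and c₊ of d coarse bonds), times 3:
3(L^{−d}P_cr + Σ_c|(Q₁B)(c)|²) ≥ κL^{−d−1}N_cr − 6dL^{−d}N_in.  κ = 1 is the PRINTED (2.127) (false as displayed: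
kernel-checked at d = 2, L = 10, `ineq2127_fails_L10`; for every L ≥ 10 in prose — Lλ₁(P_L) < 1 ⇔ L ≥ 10 —
census G-B6-09R/G-B6-10); the PROVED value is κ_L = `kappaL L` = min{1, 4L sin²(π/2L)}. [cite: Balaban1984PropagatorsII, (2.127) p.245] -/
def Step2127 (d : ℕ) (L κ : ℝ) (T : TreeData) (S : SplitData T) : Prop :=
  ∀ B, T.TreeGauge B →
    κ * (L⁻¹) ^ (d + 1) * S.nCr B - 6 * d * (L⁻¹) ^ d * S.nIn B ≤ 3 * ((L⁻¹) ^ d * S.pCr B + T.q1Sq B)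

/-- Lemma 2.4 with a general factor κ: (κ/(12d²))L^{−d−1}‖B‖² ≤ L^{d−2}Σ_c|(Q₁B)(c)|² + Σ_p|(∂₁B)(p)|² under (2.121).
κ = 1: the printed (2.128) (`lemma24K_one_iff`); κ = κ_L = min{1, 4L sin²(π/2L)} (≥ min{1, 8/L}): the repaired
Lemma 2.4′ PROVED in `HOME/b2b-balaban-b06/Lemma24-repair.md` (census G-B6-10); for L ≥ 8 its constant is
≥ (2/(3d²))L^{−d−2}. [cite: Balaban1984PropagatorsII, Lemma 2.4 (2.128) p.245] -/
def Lemma24K {I : Type} (d : ℕ) (L κ : ℝ) (fam : I → TreeData) : Prop :=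
  ∀ i : I, ∀ B : (fam i).Cfg, (fam i).TreeGauge B →
    (κ / (12 * (d : ℝ) ^ 2)) * L ^ (-((d : ℝ) + 1)) * (fam i).normSq B ≤
      L ^ ((d : ℝ) - 2) * (fam i).q1Sq B + (fam i).d1Sq B

/-- κ = 1 is literally the printed Lemma 2.4. [folklore] -/
theorem lemma24K_one_iff {I : Type} (d : ℕ) (L : ℝ) (fam : I → TreeData) :
    Lemma24K d L 1 fam ↔ Lemma24Printed d L fam := Iff.rfl

/-- Monotonicity in κ (‖B‖² ≥ 0, L > 0): a smaller factor is a weaker lemma; in particular the printed Lemma 2.4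
implies every Lemma 2.4_κ with κ ≤ 1. [folklore] -/
theorem lemma24K_mono {I : Type} (d : ℕ) (L κ κ' : ℝ) (hL : 0 < L) (hκ : κ' ≤ κ) (fam : I → TreeData)
    (hN : ∀ i B, 0 ≤ (fam i).normSq B) (h : Lemma24K d L κ fam) : Lemma24K d L κ' fam := by
  intro i B hT
  have h1 := h i B hT
  have hpow : 0 ≤ L ^ (-((d : ℝ) + 1)) := Real.rpow_nonneg hL.le _
  have hden : 0 ≤ (12 * (d : ℝ) ^ 2)⁻¹ := by positivity
  have : κ' / (12 * (d : ℝ) ^ 2) * L ^ (-((d : ℝ) + 1)) * (fam i).normSq B ≤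
      κ / (12 * (d : ℝ) ^ 2) * L ^ (-((d : ℝ) + 1)) * (fam i).normSq B := by
    rw [div_eq_mul_inv, div_eq_mul_inv]
    have := mul_le_mul_of_nonneg_right hκ (mul_nonneg (mul_nonneg hden hpow) (hN i B))
    nlinarith [this]
  exact this.trans h1

/-- **The assembly of (2.128), kernel-checked in scalar form** (census G-B6-08: "The inequalities (2.123) and (2.127)
imply many other inequalities. One of them is formulated in Lemma 2.4" — the combination is not written in print).
Weights: 1/(4d²) on the summed (2.127)_κ, 1 on the summed (2.123); x = L⁻¹ ∈ (0, 1], d ≥ 2, κ ≤ 1 (no sign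
conditions on κ, N_cr, P_in are needed); then κ x^{d+1}(N_in + N_cr) ≤ 12d²(L^{d−2}Q + P_in + P_cr).  (The naive
weights 1, 1 fail: they would need d^{−1}L^{−d} ≥ 2dL^{−d}.) [folklore] -/
theorem lemma24_assembly_core (d : ℕ) (L κ Nin Ncr Pin Pcr Q : ℝ) (hd : 2 ≤ d) (hL : 1 ≤ L)
    (hκ1 : κ ≤ 1) (hNin : 0 ≤ Nin) (hPcr : 0 ≤ Pcr) (hQ : 0 ≤ Q)
    (hI : κ * (L⁻¹) ^ (d + 1) * Ncr - 6 * d * (L⁻¹) ^ d * Nin ≤ 3 * ((L⁻¹) ^ d * Pcr + Q))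
    (hII : (L⁻¹) ^ d * Nin ≤ d * Pin) :
    κ * (L⁻¹) ^ (d + 1) * (Nin + Ncr) ≤ 12 * (d : ℝ) ^ 2 * (L ^ (d - 2) * Q + Pin + Pcr) := by
  have hd' : (2 : ℝ) ≤ d := by exact_mod_cast hd
  have hdd : (4 : ℝ) ≤ (d : ℝ) ^ 2 := by nlinarith
  have hL0 : 0 < L := by linarith
  have hx0 : 0 ≤ L⁻¹ := inv_nonneg.mpr hL0.le
  have hx1 : L⁻¹ ≤ 1 := inv_le_one_of_one_le₀ hL
  have hxd1 : (L⁻¹) ^ d ≤ 1 := pow_le_one₀ hx0 hx1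
  have hxd : (L⁻¹) ^ (d + 1) ≤ (L⁻¹) ^ d := pow_le_pow_of_le_one hx0 hx1 (Nat.le_succ d)
  have hLd : 1 ≤ L ^ (d - 2) := one_le_pow₀ hL
  -- F1: 3Q ≤ 12 d² L^{d-2} Q
  have hLQ : Q ≤ L ^ (d - 2) * Q := le_mul_of_one_le_left hQ hLd
  have F1 : 3 * Q ≤ 12 * (d : ℝ) ^ 2 * (L ^ (d - 2) * Q) := by nlinarith [hLQ, hdd, hQ]
  -- F2: 3 x^d Pcr ≤ 12 d² Pcr
  have hxP : (L⁻¹) ^ d * Pcr ≤ Pcr := mul_le_of_le_one_left hPcr hxd1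
  have F2 : 3 * ((L⁻¹) ^ d * Pcr) ≤ 12 * (d : ℝ) ^ 2 * Pcr := by nlinarith [hxP, hdd, hPcr]
  -- F3: 12 d x^d Nin ≤ 12 d² Pin
  have F3 : 12 * (d : ℝ) * ((L⁻¹) ^ d * Nin) ≤ 12 * (d : ℝ) ^ 2 * Pin := by nlinarith [hII, hd']
  -- F4: κ x^{d+1} Nin ≤ 6 d x^d Nin
  have hxN : (L⁻¹) ^ (d + 1) * Nin ≤ (L⁻¹) ^ d * Nin := mul_le_mul_of_nonneg_right hxd hNin
  have hxN0 : 0 ≤ (L⁻¹) ^ (d + 1) * Nin := mul_nonneg (pow_nonneg hx0 _) hNin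
  have hκN : κ * ((L⁻¹) ^ (d + 1) * Nin) ≤ (L⁻¹) ^ (d + 1) * Nin := mul_le_of_le_one_left hxN0 hκ1
  have hxdN0 : 0 ≤ (L⁻¹) ^ d * Nin := mul_nonneg (pow_nonneg hx0 _) hNin
  have F4 : κ * ((L⁻¹) ^ (d + 1) * Nin) ≤ 6 * (d : ℝ) * ((L⁻¹) ^ d * Nin) := by nlinarith [hκN, hxN, hxdN0, hd']
  nlinarith [hI, F1, F2, F3, F4]

/-- **Assembly of Lemma 2.4_κ from its two printed steps (kernel-checked).**  For d ≥ 2, L ≥ 1, κ ≤ 1: the summed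
(2.123) and the summed (2.127)_κ imply Lemma 2.4_κ.  With κ = 1: IF (2.127) as printed THEN (2.128) as printed — so
the printed constant 1/(12d²) is exactly what the (unwritten) assembly yields, and the only defect of the printed proof
is the sentence before (2.127) (G-B6-09); with κ = κ_L: the repaired Lemma 2.4′ (G-B6-10). [folklore] -/
theorem lemma24K_of_steps {I : Type} (d : ℕ) (L κ : ℝ) (hd : 2 ≤ d) (hL : 1 ≤ L) (hκ1 : κ ≤ 1)
    (fam : I → TreeData) (S : ∀ i, SplitData (fam i))
    (h2123 : ∀ i, Step2123 d L (fam i) (S i)) (h2127 : ∀ i, Step2127 d L κ (fam i) (S i)) :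
    Lemma24K d L κ fam := by
  intro i B hT
  have hL0 : 0 < L := by linarith
  have core := lemma24_assembly_core d L κ ((S i).nIn B) ((S i).nCr B) ((S i).pIn B) ((S i).pCr B)
    ((fam i).q1Sq B) hd hL hκ1 ((S i).nIn_nonneg B) ((S i).pCr_nonneg B) ((S i).q1_nonneg B)
    (h2127 i B hT) (h2123 i B hT)
  have e1 : L ^ (-((d : ℝ) + 1)) = (L⁻¹) ^ (d + 1) := by
    rw [Real.rpow_neg hL0.le, ← Nat.cast_succ, Real.rpow_natCast, inv_pow]
  have e2 : L ^ ((d : ℝ) - 2) = L ^ (d - 2) := by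
    have h2 : ((d - 2 : ℕ) : ℝ) = (d : ℝ) - 2 := by
      rw [Nat.cast_sub hd]; norm_num
    rw [← h2, Real.rpow_natCast]
  have hd0 : (0 : ℝ) < 12 * (d : ℝ) ^ 2 := by
    have : (2 : ℝ) ≤ d := by exact_mod_cast hd
    positivity
  rw [e1, e2, (S i).norm_split B]
  have hsplit := (S i).d1_split B
  have key : κ * (L⁻¹) ^ (d + 1) * ((S i).nIn B + (S i).nCr B) ≤
      12 * (d : ℝ) ^ 2 * (L ^ (d - 2) * (fam i).q1Sq B + (fam i).d1Sq B) := by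
    nlinarith [core, hsplit, hd0.le]
  have : κ / (12 * (d : ℝ) ^ 2) * (L⁻¹) ^ (d + 1) * ((S i).nIn B + (S i).nCr B) =
      (κ * (L⁻¹) ^ (d + 1) * ((S i).nIn B + (S i).nCr B)) / (12 * (d : ℝ) ^ 2) := by ring
  rw [this, div_le_iff₀ hd0]
  linarith [key]

/-! ### Lemma 2.4′ — the repaired factor κ_L (census G-B6-09R / G-B6-10) and the exact failure of the printed (2.127) -/

/-- The repaired factor of Lemma 2.4′: κ_L = min{1, 4L sin²(π/2L)} = min{1, L·λ₁(P_L)}, λ₁(P_L) = 2 − 2cos(π/L) the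
first non-zero (Neumann) Laplace eigenvalue of the path with L sites — the largest κ for which the sentence between
(2.126) and (2.127) is true ("the form in parentheses ≥ κL^{−d−1}Σ_{x∈Δ′}|B_μ(x)|²" for mean-zero B_μ on the
(d−1)-dimensional grid Δ′ = P_L^{□(d−1)}, whose gap is λ₁(P_L) by separation of variables); κ_L = 1 for 2 ≤ L ≤ 9,
κ₁₀ = 0.9789, κ₁₃ = 0.7555, and κ_L ≥ min{1, 8/L} (sin x ≥ (2/π)x on [0, π/2]).  Source for the path spectrum:
Brouwer–Haemers, *Spectra of Graphs* (2012) §1.4.4, §1.4.6.  Prose proofs: `HOME/b2b-balaban-r1/B6-Lemma24-proof.md`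
§3 (r1-g2), certified in `HOME/b2b-balaban-b06/Lemma24-repair.md` §3, §7. [cite: Balaban1984PropagatorsII, (2.126)–(2.128) p.245] -/
noncomputable def kappaL (L : ℕ) : ℝ := min 1 (4 * (L : ℝ) * Real.sin (Real.pi / (2 * (L : ℝ))) ^ 2)

/-- κ_L ≤ 1. [folklore] -/
theorem kappaL_le_one (L : ℕ) : kappaL L ≤ 1 := min_le_left _ _

/-- 0 ≤ κ_L. [folklore] -/
theorem kappaL_nonneg (L : ℕ) : 0 ≤ kappaL L := le_min zero_le_one (by positivity)

/-- **Lemma 2.4′ (the repaired statement).**  Under the hypotheses of Lemma 2.4 (unit lattice, B = 0 outside Λ, the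
tree gauge (2.121) in every block of Λ):
(κ_L/(12d²)) L^{−d−1} Σ_{b∈Λ}|B(b)|² ≤ L^{d−2} Σ_{c∈Λ′}|(Q₁B)(c)|² + Σ_p|(∂₁B)(p)|², i.e. `Lemma24K` with κ = κ_L.
PROVED in prose (G-B6-09R; certified, G-B6-10); in this file it follows from its two steps by the kernel-checked
assembly (`lemma24Repaired_of_steps`).  It replaces the printed Lemma 2.4 downstream at no cost: only SOME
γ′₀(d, L) > 0 is ever consumed ((2.153), (2.157); B9 p. 428; B12 (1.7)–(1.9) — census G-r2.9).  The printed constant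
(κ = 1) is neither proved nor refuted: numerically it holds with a factor ≥ 45 to spare in every computed case
(N-B6-1, N-B6-2/2b: d = 2…5, L ≤ 35). [cite: Balaban1984PropagatorsII, Lemma 2.4 (2.128) p.245] -/
def Lemma24Repaired {I : Type} (d L : ℕ) (fam : I → TreeData) : Prop := Lemma24K d (L : ℝ) (kappaL L) fam

/-- Lemma 2.4′ from the summed (2.123) and the summed (2.127)_{κ_L} (d ≥ 2, L ≥ 1), by `lemma24K_of_steps`. [folklore] -/
theorem lemma24Repaired_of_steps {I : Type} (d L : ℕ) (hd : 2 ≤ d) (hL : 1 ≤ L) (fam : I → TreeData)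
    (S : ∀ i, SplitData (fam i)) (h2123 : ∀ i, Step2123 d (L : ℝ) (fam i) (S i))
    (h2127 : ∀ i, Step2127 d (L : ℝ) (kappaL L) (fam i) (S i)) : Lemma24Repaired d L fam :=
  lemma24K_of_steps d (L : ℝ) (kappaL L) hd (Nat.one_le_cast.mpr hL) (kappaL_le_one L) fam S h2123 h2127

/-- The printed Lemma 2.4 implies Lemma 2.4′ (κ_L ≤ 1, ‖B‖² ≥ 0). [folklore] -/
theorem lemma24Repaired_of_printed {I : Type} (d L : ℕ) (hL : 1 ≤ L) (fam : I → TreeData)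
    (hN : ∀ i B, 0 ≤ (fam i).normSq B) (h : Lemma24Printed d (L : ℝ) fam) : Lemma24Repaired d L fam :=
  lemma24K_mono d (L : ℝ) 1 (kappaL L) (Nat.cast_pos.mpr (by omega)) (kappaL_le_one L) fam hN
    ((lemma24K_one_iff d (L : ℝ) fam).mpr h)

/-- φ_i := `witnessL10` (rounded first Neumann mode of P₁₀), 0 off the range. [folklore] -/
def phi10 (i : ℕ) : ℤ := witnessL10.getD i 0

/-- The d = 2, L = 10 configuration of census G-B6-09R §5.2 around the coarse bond c = ⟨(0,0), (10,0)⟩ (direction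
μ = 1; Δ′ = {x₁ = 9} ⊂ B(c₋), Δ″ = {x₁ = 10} ⊂ B(c₊)): B_μ(9,i) := 3φ_i on the 10 crossing bonds,
B(⟨(9,i),(9,i+1)⟩) := −(φ_{i+1} − φ_i) on Δ′, B(⟨(10,i),(10,i+1)⟩) := +(φ_{i+1} − φ_i) on Δ″, every other bond 0.
`plaqL10 i` = the circulation (∂₁B) around the i-th crossing plaquette (corners (9,i), (10,i), (10,i+1), (9,i+1)):
bottom + right − top − left. [cite: Balaban1984PropagatorsII, (2.124)–(2.127) p.245] -/
def plaqL10 (i : ℕ) : ℤ :=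
  3 * phi10 i + (phi10 (i + 1) - phi10 i) - 3 * phi10 (i + 1) - (-(phi10 (i + 1) - phi10 i))

/-- On every crossing plaquette the circulation is −∇φ. [folklore] -/
theorem plaqL10_eq (i : ℕ) : plaqL10 i = -(phi10 (i + 1) - phi10 i) := by
  unfold plaqL10; ring

/-- The four sums entering (2.127) for this configuration (kernel-checked by `decide`):
Σ_{p∈P(c)}|∂₁B(p)|² = 489 500 (= D), Σ_{x∈Δ′}B_μ(x) = 0 (hence (Q₁B)(c) = 3·10⁻²·Σφ = 0 by (2.125)),
Σ_{x∈Δ′}|B_μ(x)|² = 9·5 000 652 (= 9S), Σ_{b⊂Δ′}|B(b)|² = Σ_{b⊂Δ″}|B(b)|² = 489 500 (= D; no other bond of B(c₋),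
B(c₊) carries B ≠ 0). [folklore] -/
theorem faceL10_sums :
    ((List.range 9).map fun i => plaqL10 i ^ 2).sum = 489500 ∧
    ((List.range 10).map fun i => 3 * phi10 i).sum = 0 ∧
    ((List.range 10).map fun i => (3 * phi10 i) ^ 2).sum = 9 * 5000652 ∧
    ((List.range 9).map fun i => (phi10 (i + 1) - phi10 i) ^ 2).sum = 489500 := by
  decide

/-- **The printed (2.127) is FALSE (d = 2, L = 10; census G-B6-09R §5.2 by r1-g2, certified G-B6-10).**  (2.127) is
displayed inside the proof of Lemma 2.4 without a quantifier, and its derivation ((2.124)–(2.126) + the sentence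
refuted by `claim_p245_fails_L10`) uses no gauge condition, so it is asserted for arbitrary B.  On the configuration
of `plaqL10`/`faceL10_sums`: LHS(2.127) = L^{−d}Σ_{p∈P(c)}|∂₁B|² + |(Q₁B)(c)|² = 489500/100 + 0 = 4895, while
RHS(2.127) = ⅓L^{−d−1}Σ_{x∈Δ′}|B_μ|² − L^{−d}Σ_{Δ′-side}|B|² − L^{−d}Σ_{Δ″-side}|B|² = 9·5000652/3000 − 2·489500/100
= 1302989/250 = 5211.956 > 4895.  In general this family turns (2.127) into LΣ|∇φ|² ≥ Σφ², false for every L ≥ 10;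
restricted to tree-gauge configurations (Δ″-bonds in the comb of B(c₊) forced to 0, witness weight −3/2 on Δ′) it
still fails as soon as Lλ₁(P_L) < 2/3, i.e. for every L ≥ 15 — no reading of (2.127) survives for all L.  The repaired
(2.127)_{κ_L} holds on the same vector with slack 0.050 (r1-g2 §6). [folklore] -/
theorem ineq2127_fails_L10 :
    ((((List.range 9).map fun i => plaqL10 i ^ 2).sum : ℤ) : ℚ) / 10 ^ 2
        + (((((List.range 10).map fun i => 3 * phi10 i).sum : ℤ) : ℚ) / 10 ^ 2) ^ 2 <
      (1 / 3) * (1 / 10 ^ 3) * ((((List.range 10).map fun i => (3 * phi10 i) ^ 2).sum : ℤ) : ℚ)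
        - ((((List.range 9).map fun i => (phi10 (i + 1) - phi10 i) ^ 2).sum : ℤ) : ℚ) / 10 ^ 2
        - ((((List.range 9).map fun i => (phi10 (i + 1) - phi10 i) ^ 2).sum : ℤ) : ℚ) / 10 ^ 2 := by
  obtain ⟨h1, h2, h3, h4⟩ := faceL10_sums
  rw [h1, h2, h3, h4]
  norm_num

/-- The same in closed form: 4895 < 1302989/250 (= 5211.956). [folklore] -/
theorem ineq2127_fails_L10_value : (489500 : ℚ) / 100 + (0 / 100) ^ 2 < 9 * 5000652 / 3000 - 2 * (489500 / 100) ∧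
    (9 * 5000652 / 3000 - 2 * (489500 / 100) : ℚ) = 1302989 / 250 := by
  constructor <;> norm_num

/-- (2.153) p. 249 with the factor κ: Δ_k ≥ (γ₀κ/(12d²))L^{−d−1} on the subspace {QB = 0, B(Γ_{y,x}) = 0}
(κ = 1 printed; κ = κ_L repaired — only "a positive constant γ′₀(d, L)" is used downstream, B9 p. 428, B12 (1.7)–(1.9):
census G-r2.9). [cite: Balaban1984PropagatorsII, (2.153) p.249] -/
def LowerBound2153K {I : Type} (d : ℕ) (L γ₀ κ : ℝ) (fam : I → TreeData)
    (formΔk : ∀ i, (fam i).Cfg → ℝ) (QZero : ∀ i, (fam i).Cfg → Prop) : Prop :=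
  ∀ i : I, ∀ B : (fam i).Cfg, (fam i).TreeGauge B → QZero i B →
    (γ₀ * κ / (12 * (d : ℝ) ^ 2)) * L ^ (-((d : ℝ) + 1)) * (fam i).normSq B ≤ formΔk i B

/-- Bookkeeping (kernel-checked): (2.153)_κ from Lemma 2.4_κ and (2.118) (= B5 (1.67), γ₀ ≥ 0) once QB = 0 kills the
Q₁-term — the same two-line argument as the printed one, with the factor carried along. [folklore] -/
theorem lowerBound2153K_of_lemma24K {I : Type} (d : ℕ) (L γ₀ κ : ℝ) (hγ : 0 ≤ γ₀) (fam : I → TreeData)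
    (formΔk : ∀ i, (fam i).Cfg → ℝ) (QZero : ∀ i, (fam i).Cfg → Prop)
    (h24 : Lemma24K d L κ fam)
    (hQ : ∀ i B, QZero i B → (fam i).q1Sq B = 0)
    (h2118 : ∀ i B, γ₀ * (fam i).d1Sq B ≤ formΔk i B) :
    LowerBound2153K d L γ₀ κ fam formΔk QZero := by
  intro i B hT hQ0
  have h := h24 i B hT
  rw [hQ i B hQ0, mul_zero, zero_add] at h
  have h' := mul_le_mul_of_nonneg_left h hγ
  calc γ₀ * κ / (12 * (d : ℝ) ^ 2) * L ^ (-((d : ℝ) + 1)) * (fam i).normSq B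
      = γ₀ * (κ / (12 * (d : ℝ) ^ 2) * L ^ (-((d : ℝ) + 1)) * (fam i).normSq B) := by ring
    _ ≤ γ₀ * (fam i).d1Sq B := h'
    _ ≤ formΔk i B := h2118 i B

/-- DAG edge B5 (1.67) → B6 (2.118)/(2.153) (kernel-checked): if the unit-lattice forms of the family are B5's
`FormData` with `B5.Bounds167` (2.118), then the hypothesis `h2118` of `lowerBound2153K_of_lemma24K` holds with
B5's γ₀ > 0. [folklore] -/
theorem h2118_of_B5 {I : Type} (famF : I → B5.FormData) (h : B5.Bounds167 famF) :
    ∃ γ₀ : ℝ, 0 < γ₀ ∧ ∀ i B, γ₀ * (famF i).d1Sq B ≤ (famF i).formΔk B := by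
  obtain ⟨γ₀, γ₁, hγ₀, _, hB⟩ := h
  exact ⟨γ₀, hγ₀, fun i B => (hB i B).1⟩

/-- (2.155)–(2.157) p. 250, kernel-checked bookkeeping: after eliminating the δ-constrained variables (B = CB′,
‖CB′‖² ≥ ‖B′‖²) a lower bound c‖CB′‖² ≤ ⟨CB′, Δ_kCB′⟩ with c ≥ 0 gives ⟨B′, C*Δ_kCB′⟩ ≥ c‖B′‖² = γ′₀‖B′‖² (2.157) —
the positivity input of B4's Sect. 5 Theorem applied to C*Δ_kC (here the reduction to a coordinate restriction IS
written in print, cf. census C-B4-1). [cite: Balaban1984PropagatorsII, (2.155)–(2.157) p.250] -/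
theorem bound2157 (c nB' nCB' form : ℝ) (hc : 0 ≤ c) (h1 : nB' ≤ nCB') (h2 : c * nCB' ≤ form) :
    c * nB' ≤ form :=
  (mul_le_mul_of_nonneg_left h1 hc).trans h2

/-- Convergence bookkeeping of the random-walk expansions (2.50), (2.86), (2.141) (Props. 2.2, 2.3, 2.6, 2.7),
kernel-checked in the scalar form in which the text uses it: if the n-th term of a kernel expansion is bounded by
A(c₁θ)ⁿ (Lemma 2.1 (2.62)–(2.63): each intermediate 𝔅-sum costs c₁(α); each factor R costs θ = O(M⁻¹) by
(2.51)/(2.85)/(2.135)) and c₁θ < 1 ("for M sufficiently large"), then the series converges absolutely and its sum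
is bounded by A/(1 − c₁θ). [folklore] -/
theorem neumann_majorant (A c₁ θ : ℝ) (h0 : 0 ≤ c₁ * θ) (h1 : c₁ * θ < 1) (a : ℕ → ℝ)
    (ha : ∀ n, |a n| ≤ A * (c₁ * θ) ^ n) : Summable a ∧ |∑' n, a n| ≤ A / (1 - c₁ * θ) := by
  have hg : HasSum (fun n => A * (c₁ * θ) ^ n) (A / (1 - c₁ * θ)) := by
    have := (hasSum_geometric_of_lt_one h0 h1).mul_left A
    simpa [div_eq_mul_inv] using this
  have hb : ∀ n, ‖a n‖ ≤ A * (c₁ * θ) ^ n := fun n => by simpa [Real.norm_eq_abs] using ha n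
  have hs : Summable a := hg.summable.of_norm_bounded hb
  refine ⟨hs, ?_⟩
  have := tsum_of_norm_bounded hg hb
  simpa [Real.norm_eq_abs] using this

/-! ### The stated block of B6 (for `Dag.Leaves.b6` / `DagBinding.Upstream.b6`) -/

/-- All carriers of the statements of B6 in one bundle: the multiscale geometries (2.1)–(2.2) with the operators
G′, (Q′G′²Q′*)⁻¹, G, (QGQ*)⁻¹, H seen through their printed functionals (Lemma 2.1, Props. 2.2, 2.3, 2.6, 2.7,
Cor. 2.8), the unit-lattice tree-gauge data of Lemma 2.4, and the local operators G_□ of Prop. 2.5. [cite: Balaban1984PropagatorsII, pp.223–250] -/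
structure BlockData where
  I : Type
  d : ℕ
  L : ℝ
  δ₀ : ℝ
  geo : I → Geometry
  Gp : ∀ i, GpFamily (geo i)
  Cinv : ∀ i, SiteKernel (geo i)
  G : ∀ i, GFamily (geo i)
  Qinv : ∀ i, SiteKernel (geo i)
  H : ∀ i, HFamily (geo i)
  J : Type
  tree : J → TreeData
  K : Type
  loc : K → LocalOp

/-- **The stated block of B6** = Lemma 2.1 ∧ Prop. 2.2 ∧ Prop. 2.3 ∧ Lemma 2.4 ∧ Prop. 2.5 ∧ Prop. 2.6 ∧ Prop. 2.7 ∧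
Cor. 2.8, each the verbatim printed statement over its carrier.  This is the Prop a binder substitutes for the
abstract leaf `Dag.Leaves.b6` / `DagBinding.Upstream.b6` (node N03: `Dag.B6_main ℓ = ℓ.b4 → ℓ.b5 → ℓ.b6`).  It is a
CLAIM UNDER ADJUDICATION, consumed only as a hypothesis; the cell's census of its printed proofs: C-B6-1…5
(certified steps), G-B6-01…12 (located objections), of which G-B6-09 is a kernel-checked FALSE intermediate claim
(`claim_p245_fails_L10`, `ineq2127_fails_L10`) with a proved repair (G-B6-09R/G-B6-10, `Lemma24Repaired`) that
leaves this block's Lemma 2.4 numerically supported but, as printed, unproved. [cite: Balaban1984PropagatorsII, pp.223–250] -/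
def StatedBlock (D : BlockData) : Prop :=
  Lemma21Printed D.d D.δ₀ D.geo ∧ Prop22Printed D.geo D.Gp ∧ Prop23Printed D.d D.geo D.Cinv ∧
  Lemma24Printed D.d D.L D.tree ∧ Prop25Printed D.loc ∧ Prop26Printed D.geo D.G ∧
  Prop27Printed D.d D.geo D.Qinv ∧ Cor28Printed D.d D.geo D.H

/-- "This Corollary and Proposition 2.6 are our main technical results. They will be used systematically in
subsequent papers." (p. 249) — the sub-block B9 Cor. 3.5 imports as its U = 1 base. [cite: Balaban1984PropagatorsII, p.249] -/
def MainResults (D : BlockData) : Prop :=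
  Prop26Printed D.geo D.G ∧ Cor28Printed D.d D.geo D.H

/-- Bookkeeping: the stated block contains the main results. [folklore] -/
theorem mainResults_of_statedBlock (D : BlockData) (h : StatedBlock D) : MainResults D :=
  ⟨h.2.2.2.2.2.1, h.2.2.2.2.2.2.2⟩

/-- Bookkeeping: the stated block with Lemma 2.4 weakened to any factor κ ≤ 1 (e.g. the repaired κ_L) follows from
the stated block (L > 0, ‖B‖² ≥ 0) — replacing the printed Lemma 2.4 by the repaired one costs nothing downstream. [folklore] -/
theorem lemma24K_of_statedBlock (D : BlockData) (κ : ℝ) (hL : 0 < D.L) (hκ : κ ≤ 1)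
    (hN : ∀ j B, 0 ≤ (D.tree j).normSq B) (h : StatedBlock D) : Lemma24K D.d D.L κ D.tree :=
  lemma24K_mono D.d D.L 1 κ hL hκ D.tree hN ((lemma24K_one_iff D.d D.L D.tree).mpr h.2.2.2.1)


end Literature.MathematicalPhysics.QuantumFieldTheory.Balaban1983to89.B6
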